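/-
Copyright (c) 2026 the pub-hodgecm-mathlib formalisation cell (harness21).  Prover seat hodgecm-mathlib-K2E1-p11 (g2), Track B ∕ K2-LIT, h413 =
`stmt-HodgeConjecture-24833`, line `K2_E1_TraceFormulaBeta`, 5Res campaign «ENDGAME BY FAMILIES» ∕ ROADCARD §3′ (M2 v2, amendment #2 (228)(i′)), ruling (244)(x1) FILE A: the SMOOTHING
PROFILE of a radial×section test field under a `K_∞`-central pure tensor — `R(h)((f∘H)·φ) = (g∘H)·φ` with `g ∈ C²_c((0,∞))` EXPLICIT and `mellin g = s_h(−·)·mellin f` — the index-class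
stability behind the operator form `U R(h) = M_{s_h} U` of the letters `hU`∕`hscalar` (FILE B).
-/
import Summits.HodgeConjecture.HodgeConjecture.Theorems.K2E1ArchSphericalTypeSymbolActionU2          -- ★ D4′d p860404 (this seat): `symbol_eq_integral_of_mem_K`, `exists_apply_ne_zero_of_mem_K[_cm]`; brings `chiSectionSpace`, `IsChiSection`, ★ P5 Iwasawa bricks
import Summits.HodgeConjecture.HodgeConjecture.Theorems.K2E1PseudoEisensteinHeckeIntertwiningCMTwo   -- ★ P3b FILE 2 p860039 (this seat): `hasCompactSupport_/tsupport_/continuous_/contDiff_/mellin_radialConv`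
import Summits.HodgeConjecture.HodgeConjecture.Theorems.K2E1MellinPaleyWienerHalfLine                 -- ★ A p859444 (K2E3-p12): `mellinConvergent_of_tsupport_subset_Ioi`, `verticalIntegrable_mellin`
import Mathlib.Analysis.MellinInversion
import HarnessLib

/-!
# (x1) FILE A — `K2E1ChiSectionSmoothingProfileU2`: `R(h)((f∘H)·φ) = (g∘H)·φ` with an explicit `g ∈ C²_c((0,∞))`, `mellin g = s_h(−·)·mellin f` — the `χ`-section pseudo-Eisenstein
# index class is STABLE under `K_∞`-central pure tensors (Mellin injectivity, no Paley–Wiener)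

Cell `pub/hodgecm-mathlib`, crux H413 = `stmt-HodgeConjecture-24833`, route `HCCMUnconditional`; dealer K2E1-plan (g7) ruling (244) «(x1) the OPERATOR FORM hU∕hscalar».  THEOREMS ONLY (no
`def` ∕ `instance` ∕ `notation` ∕ named-fact hypothesis ∕ `sorry`); lane `--kind proof --supports stmt-HodgeConjecture-24833 --as helper` (count-neutral; closes no socket).  Generic
`(F, E, c)`, every rank `N`; the adelic Iwasawa decomposition is the letter `hBK` (hypothesis-free for the CM pair, §4).
THE MATHEMATICS ([MoeglinWaldspurger1995, II.1.2–II.1.4, II.2.4]; [BernsteinLapid2019, §4 Claim 1]; [Titchmarsh1948, §1.29, Thm 71–72]).  Fix a continuous compactly supported `h` on `G(𝔸)`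
acting on the flat `χ`-sections of a continuous `χ`-section `φ` by a scalar (★ P1 ∕ ★ 12d-C, binder `hact : ∫ h(y)·f_z^φ(x·y) dν_G = s(z)·f_z^φ(x)` for all `z, x`), a point `k₀ ∈ K` with
`φ(k₀) ≠ 0` (★ D4′d §2), and a radial profile `f ∈ C²_c((0,∞))`.  PUT **`g(r) := ∫ f(r·H(y))·κ(y) dν_G(y)`, `κ := h(k₀⁻¹·)·φ∕φ(k₀) ∈ C_c(G(𝔸))`** — the profile of ★ P3b FILE 2 with kernel `κ`;
so `g ∈ C²_c((0,∞))` (★ `contDiff_∕hasCompactSupport_∕tsupport_radialConv`) and (§2) **`mellin g w = s(−w)·mellin f w`** (★ `mellin_radialConv`: multiplier `∫ κ·H^{−w}`, which after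
`y ↦ k₀y` is the normalised symbol integral of ★ D4′d `symbol_eq_integral_of_mem_K` at `z = −w`).  (§3) **`R(h)((f∘H)·φ)(x) = g(H(x))·φ(x)` for every `x`**: write `x = bk`; by
`H(bky) = H(bk)H(ky)` and `φ(bky) = χ(b₀₀)φ(ky)` both sides are `χ(b₀₀)` times an `r`-profile evaluated at `r = H(x)` — `F_k(r) = ∫ h(y)f(rH(ky))φ(ky) dν_G` resp. `φ(k)·g(r)` — and these
two members of `C²_c((0,∞))` have THE SAME MELLIN TRANSFORM (`s(−w)·φ(k)·mellin f w`, by `hact` at `x = k`), hence coincide (§1: MELLIN INJECTIVITY on `C²_c((0,∞))`, Mathlib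
`mellinInv_mellin_eq` with ★ A's `mellinConvergent_of_tsupport_subset_Ioi`∕`verticalIntegrable_mellin`).  No Paley–Wiener theorem is needed: `g` is explicit.  (§2′) On the unitary axis
`mellin g (−(½+iy)) = s(½+iy)·mellin f (−(½+iy))`, i.e. the model vector `u_{(g,φ)} = M_{s}u_{(f,φ)}` of ★ K2E4-p10 `exists_linearIsometry_chiSection_offDual_cm_two`.
* §1 **`eq_of_mellin_eq`**.  * §2 `continuous_smoothingKernel`, `hasCompactSupport_smoothingKernel`, **`contDiff_smoothingProfile`**, **`hasCompactSupport_smoothingProfile`**,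
  **`tsupport_smoothingProfile_subset_Ioi`**, `integral_smoothingKernel_mul_cpow_eq_symbol`, **`mellin_smoothingProfile`**, `mellin_smoothingProfile_axis`.
* §3 `integral_mul_flatSectionU_eq_at_K`, **`rightConv_comp_borelHeight_mul_section`** (Iwasawa letter).  * §4 **`rightConv_comp_borelHeight_mul_section_cm`** (CM pair, hypothesis-free).
HONEST LABEL.  Count-neutral helper; proves no printed statement; letter-free except the binders `hact` (= ★ P1's clause) and `hBK`; the Eisenstein∕`L²`-operator level and the closed-span
passage are FILE B.  HC_CM is proved only modulo the 7 printed citations (2 remaining named inputs: hLiu418 = `stmt-HodgeConjecture-24832`, h413 = `stmt-HodgeConjecture-24833`) until rung 0 closes.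

## References
* [MoeglinWaldspurger1995] C. Mœglin, J.-L. Waldspurger, *Spectral decomposition and Eisenstein series* (1995), II.1.2–II.1.4, II.2.4.
* [BernsteinLapid2019] J. Bernstein, E. Lapid, *On the meromorphic continuation of Eisenstein series*, J. AMS 37 (2024), §4 Claim 1.
* [Titchmarsh1948] E. C. Titchmarsh, *Introduction to the Theory of Fourier Integrals* (1948), §1.29 and Thms 71–72 (Mellin inversion).
-/

set_option autoImplicit false
-- the mandated namespace repeats `HodgeConjecture.HodgeConjecture`, as in every `Theorems/*.lean` of this sub-problem
set_option linter.dupNamespace false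

noncomputable section

open MeasureTheory MeasureTheory.Measure Set Filter Topology Complex NumberField
open scoped NNReal
open Literature.NumberTheory.Automorphic Literature.NumberTheory.Automorphic.UnitaryGroup AdelicGroupData
open Literature.NumberTheory.GaloisRepresentations (HeckeCharacter)
open Summit.HodgeConjecture.HodgeConjecture.Cruxes.H413.K2E1BorelEisensteinU
open Summit.HodgeConjecture.HodgeConjecture.Cruxes.H413.K2E1CharacterEisensteinU2Defs
open Summit.HodgeConjecture.HodgeConjecture.Cruxes.H413.K2E1SphericalHeckeEigenSectionU2 (continuous_borelHeight_coe borelHeight_coe_pos borelHeight_eq_one_of_mem borelHeight_borel_mul_mul)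
open Summit.HodgeConjecture.HodgeConjecture.Cruxes.H413.K2E1PseudoEisensteinHeckeIntertwiningCMTwo (hasCompactSupport_radialConv tsupport_radialConv_subset_Ioi continuous_radialConv contDiff_radialConv
  mellin_radialConv)
open Summit.HodgeConjecture.HodgeConjecture.Cruxes.H413.K2E1MellinPaleyWienerHalfLine (mellinConvergent_of_tsupport_subset_Ioi verticalIntegrable_mellin)
open Summit.HodgeConjecture.HodgeConjecture.Cruxes.H413.K2E1ArchSphericalTypeSymbolActionU2 (symbol_eq_integral_of_mem_K exists_apply_ne_zero_of_mem_K)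

namespace Summit.HodgeConjecture.HodgeConjecture.Cruxes.H413.K2E1ChiSectionSmoothingProfileU2

/-! ## §1 Mellin injectivity on `C²_c((0,∞))` -/

/-- **MELLIN INJECTIVITY ON `C²_c((0,∞))`**: two `C²` functions with compact support in `(0,∞)` and the same Mellin transform coincide (Mathlib `mellinInv_mellin_eq` at `σ = 0`; on `(−∞,0]`
both vanish). [cite: Titchmarsh1948, Thm 71–72] -/
theorem eq_of_mellin_eq {F G : ℝ → ℂ} (hF : ContDiff ℝ 2 F) (hFs : HasCompactSupport F) (hF0 : tsupport F ⊆ Ioi 0)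
    (hG : ContDiff ℝ 2 G) (hGs : HasCompactSupport G) (hG0 : tsupport G ⊆ Ioi 0) (h : ∀ s : ℂ, mellin F s = mellin G s) : F = G := by
  have hm : mellin F = mellin G := funext h
  funext r
  by_cases hr : 0 < r
  · rw [← mellinInv_mellin_eq 0 F hr (mellinConvergent_of_tsupport_subset_Ioi hF.continuous hFs hF0 _) (verticalIntegrable_mellin hF hFs hF0 0) hF.continuous.continuousAt,
      ← mellinInv_mellin_eq 0 G hr (mellinConvergent_of_tsupport_subset_Ioi hG.continuous hGs hG0 _) (verticalIntegrable_mellin hG hGs hG0 0) hG.continuous.continuousAt, hm]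
  · rw [image_eq_zero_of_notMem_tsupport fun hm' => hr (hF0 hm'), image_eq_zero_of_notMem_tsupport fun hm' => hr (hG0 hm')]

/-! ## §2 The smoothing profile `g(r) = ∫ f(r·H(y))·κ(y) dν_G`, `κ = h(k₀⁻¹·)·φ∕φ(k₀)` -/

section Generic

variable {F E : Type} [Field F] [NumberField F] [Field E] [NumberField E] [Algebra F E] {c : E ≃ₐ[F] E} {N : ℕ} [NeZero N]

omit [NeZero N] in
/-- The smoothing kernel `κ(y) = h(k₀⁻¹y)·φ(y)∕φ(k₀)` is continuous. [folklore] -/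
theorem continuous_smoothingKernel {h φ : (quasiSplit F E c N).Adelic → ℂ} (hh : Continuous h) (hφc : Continuous φ) (k₀ : (quasiSplit F E c N).Adelic) :
    Continuous fun y : (quasiSplit F E c N).Adelic => h (k₀⁻¹ * y) * (φ y / φ k₀) :=
  (hh.comp (continuous_const.mul continuous_id)).mul (hφc.div_const _)

omit [NeZero N] in
/-- The smoothing kernel `κ` has compact support (`h` has). [folklore] -/
theorem hasCompactSupport_smoothingKernel {h : (quasiSplit F E c N).Adelic → ℂ} (hhs : HasCompactSupport h) (φ : (quasiSplit F E c N).Adelic → ℂ) (k₀ : (quasiSplit F E c N).Adelic) :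
    HasCompactSupport fun y : (quasiSplit F E c N).Adelic => h (k₀⁻¹ * y) * (φ y / φ k₀) :=
  (hhs.comp_homeomorph (Homeomorph.mulLeft k₀⁻¹)).mul_right

variable [MeasurableSpace (quasiSplit F E c N).Adelic] [BorelSpace (quasiSplit F E c N).Adelic]

/-- **`g ∈ C^n` when `f ∈ C^n_c`** (★ `contDiff_radialConv` with kernel `κ`). [cite: MoeglinWaldspurger1995, II.1.2] -/
theorem contDiff_smoothingProfile (νG : Measure (quasiSplit F E c N).Adelic) [IsFiniteMeasureOnCompacts νG] {h φ : (quasiSplit F E c N).Adelic → ℂ} (hh : Continuous h) (hhs : HasCompactSupport h) (hφc : Continuous φ)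
    (k₀ : (quasiSplit F E c N).Adelic) {f : ℝ → ℂ} {n : ℕ} (hf : ContDiff ℝ n f) (hfs : HasCompactSupport f) :
    ContDiff ℝ n fun r : ℝ => ∫ y, f (r * (borelHeight y : ℝ)) * (h (k₀⁻¹ * y) * (φ y / φ k₀)) ∂νG :=
  contDiff_radialConv νG (continuous_smoothingKernel hh hφc k₀) (hasCompactSupport_smoothingKernel hhs φ k₀) hf hfs

omit [BorelSpace (quasiSplit F E c N).Adelic] in
/-- **`g` HAS COMPACT SUPPORT** (★ `hasCompactSupport_radialConv`). [cite: MoeglinWaldspurger1995, II.1.2] -/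
theorem hasCompactSupport_smoothingProfile (νG : Measure (quasiSplit F E c N).Adelic) {h : (quasiSplit F E c N).Adelic → ℂ} (hhs : HasCompactSupport h) (φ : (quasiSplit F E c N).Adelic → ℂ) (k₀ : (quasiSplit F E c N).Adelic) {f : ℝ → ℂ}
    (hfs : HasCompactSupport f) (hf0 : tsupport f ⊆ Ioi 0) :
    HasCompactSupport fun r : ℝ => ∫ y, f (r * (borelHeight y : ℝ)) * (h (k₀⁻¹ * y) * (φ y / φ k₀)) ∂νG :=
  hasCompactSupport_radialConv νG (hasCompactSupport_smoothingKernel hhs φ k₀) hfs hf0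

omit [BorelSpace (quasiSplit F E c N).Adelic] in
/-- **`tsupport g ⊆ (0,∞)`** (★ `tsupport_radialConv_subset_Ioi`). [cite: MoeglinWaldspurger1995, II.1.2] -/
theorem tsupport_smoothingProfile_subset_Ioi (νG : Measure (quasiSplit F E c N).Adelic) {h : (quasiSplit F E c N).Adelic → ℂ} (hhs : HasCompactSupport h) (φ : (quasiSplit F E c N).Adelic → ℂ) (k₀ : (quasiSplit F E c N).Adelic) {f : ℝ → ℂ}
    (hfs : HasCompactSupport f) (hf0 : tsupport f ⊆ Ioi 0) :
    tsupport (fun r : ℝ => ∫ y, f (r * (borelHeight y : ℝ)) * (h (k₀⁻¹ * y) * (φ y / φ k₀)) ∂νG) ⊆ Ioi 0 :=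
  tsupport_radialConv_subset_Ioi νG (hasCompactSupport_smoothingKernel hhs φ k₀) hfs hf0

/-- **THE KERNEL'S MULTIPLIER IS THE SYMBOL**: `∫ κ(y)·H(y)^z dν_G = s(z)` — substitute `y ↦ k₀y` (left invariance) and read ★ D4′d `symbol_eq_integral_of_mem_K` (`H(k₀) = 1`).
[cite: BernsteinLapid2019, §4 Claim 1] -/
theorem integral_smoothingKernel_mul_cpow_eq_symbol (νG : Measure (quasiSplit F E c N).Adelic) [νG.IsMulLeftInvariant] {h φ : (quasiSplit F E c N).Adelic → ℂ} {k₀ : (quasiSplit F E c N).Adelic}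
    (hk₀ : adelicVal F E c N ((StdForm.antidiagonal N).over E) k₀ ∈ standardMaximalCompactGL N E) (hx₀ : φ k₀ ≠ 0) {s : ℂ → ℂ}
    (hact : ∀ z : ℂ, ∫ y, h y * flatSectionU φ z (k₀ * y) ∂νG = s z * flatSectionU φ z k₀) (z : ℂ) :
    ∫ y, h (k₀⁻¹ * y) * (φ y / φ k₀) * ((((borelHeight y : ℝ≥0) : ℝ) : ℂ) ^ z) ∂νG = s z := by
  rw [symbol_eq_integral_of_mem_K νG hk₀ hact hx₀ z,
    ← integral_mul_left_eq_self (fun y : (quasiSplit F E c N).Adelic => h (k₀⁻¹ * y) * (φ y / φ k₀) * ((((borelHeight y : ℝ≥0) : ℝ) : ℂ) ^ z)) k₀]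
  refine integral_congr_ae (Eventually.of_forall fun y => ?_)
  show h (k₀⁻¹ * (k₀ * y)) * (φ (k₀ * y) / φ k₀) * ((((borelHeight (k₀ * y) : ℝ≥0) : ℝ) : ℂ) ^ z) = h y * ((φ (k₀ * y) / φ k₀) * ((((borelHeight (k₀ * y) : ℝ≥0) : ℝ) : ℂ) ^ z))
  rw [inv_mul_cancel_left, mul_assoc]

/-- **THE MELLIN MULTIPLIER OF THE SMOOTHING PROFILE**: `mellin g w = s(−w)·mellin f w` (★ `mellin_radialConv` with kernel `κ`, then the previous lemma at `z = −w`).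
[cite: MoeglinWaldspurger1995, II.1.3–II.1.4] [cite: Titchmarsh1948, §1.29] -/
theorem mellin_smoothingProfile (νG : Measure (quasiSplit F E c N).Adelic) [IsFiniteMeasureOnCompacts νG] [SFinite νG] [νG.IsMulLeftInvariant] {h φ : (quasiSplit F E c N).Adelic → ℂ} (hh : Continuous h)
    (hhs : HasCompactSupport h) (hφc : Continuous φ) {k₀ : (quasiSplit F E c N).Adelic} (hk₀ : adelicVal F E c N ((StdForm.antidiagonal N).over E) k₀ ∈ standardMaximalCompactGL N E) (hx₀ : φ k₀ ≠ 0)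
    {s : ℂ → ℂ} (hact : ∀ z : ℂ, ∫ y, h y * flatSectionU φ z (k₀ * y) ∂νG = s z * flatSectionU φ z k₀)
    {f : ℝ → ℂ} (hfc : Continuous f) (hfs : HasCompactSupport f) (hf0 : tsupport f ⊆ Ioi 0) (w : ℂ) :
    mellin (fun r : ℝ => ∫ y, f (r * (borelHeight y : ℝ)) * (h (k₀⁻¹ * y) * (φ y / φ k₀)) ∂νG) w = s (-w) * mellin f w := by
  rw [mellin_radialConv νG (continuous_smoothingKernel hh hφc k₀) (hasCompactSupport_smoothingKernel hhs φ k₀) hfc hfs hf0 w,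
    integral_smoothingKernel_mul_cpow_eq_symbol νG hk₀ hx₀ hact (-w)]

/-- **ON THE UNITARY AXIS**: `mellin g (−(½+iy)) = s(½+iy)·mellin f (−(½+iy))` — the model vector of `(g, φ)` is `M_s` applied to that of `(f, φ)` (★ K2E4-p10's `u_i` bytes).
[cite: MoeglinWaldspurger1995, II.2.4] -/
theorem mellin_smoothingProfile_axis (νG : Measure (quasiSplit F E c N).Adelic) [IsFiniteMeasureOnCompacts νG] [SFinite νG] [νG.IsMulLeftInvariant] {h φ : (quasiSplit F E c N).Adelic → ℂ} (hh : Continuous h)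
    (hhs : HasCompactSupport h) (hφc : Continuous φ) {k₀ : (quasiSplit F E c N).Adelic} (hk₀ : adelicVal F E c N ((StdForm.antidiagonal N).over E) k₀ ∈ standardMaximalCompactGL N E) (hx₀ : φ k₀ ≠ 0)
    {s : ℂ → ℂ} (hact : ∀ z : ℂ, ∫ y, h y * flatSectionU φ z (k₀ * y) ∂νG = s z * flatSectionU φ z k₀)
    {f : ℝ → ℂ} (hfc : Continuous f) (hfs : HasCompactSupport f) (hf0 : tsupport f ⊆ Ioi 0) (y : ℝ) :
    mellin (fun r : ℝ => ∫ y, f (r * (borelHeight y : ℝ)) * (h (k₀⁻¹ * y) * (φ y / φ k₀)) ∂νG) (-((((1 / 2 : ℝ)) : ℂ) + y * I)) =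
      s ((((1 / 2 : ℝ)) : ℂ) + y * I) * mellin f (-((((1 / 2 : ℝ)) : ℂ) + y * I)) := by
  rw [mellin_smoothingProfile νG hh hhs hφc hk₀ hx₀ hact hfc hfs hf0, neg_neg]

/-! ## §3 `R(h)((f∘H)·φ) = (g∘H)·φ` pointwise -/

/-- The substitution `y ↦ ky` in the kernel multiplier: `∫ h(k⁻¹y)·φ(y)·H(y)^{−w} dν_G = ∫ h(y)·φ(ky)·H(ky)^{−w} dν_G` (left invariance). [folklore] -/
theorem integral_mul_flatSectionU_eq_at_K (νG : Measure (quasiSplit F E c N).Adelic) [νG.IsMulLeftInvariant] (h φ : (quasiSplit F E c N).Adelic → ℂ) (k : (quasiSplit F E c N).Adelic) (w : ℂ) :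
    ∫ y, h (k⁻¹ * y) * φ y * ((((borelHeight y : ℝ≥0) : ℝ) : ℂ) ^ (-w)) ∂νG = ∫ y, h y * (φ (k * y) * ((((borelHeight (k * y) : ℝ≥0) : ℝ) : ℂ) ^ (-w))) ∂νG := by
  rw [← integral_mul_left_eq_self (fun y : (quasiSplit F E c N).Adelic => h (k⁻¹ * y) * φ y * ((((borelHeight y : ℝ≥0) : ℝ) : ℂ) ^ (-w))) k]
  refine integral_congr_ae (Eventually.of_forall fun y => ?_)
  show h (k⁻¹ * (k * y)) * φ (k * y) * ((((borelHeight (k * y) : ℝ≥0) : ℝ) : ℂ) ^ (-w)) = h y * (φ (k * y) * ((((borelHeight (k * y) : ℝ≥0) : ℝ) : ℂ) ^ (-w)))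
  rw [inv_mul_cancel_left, mul_assoc]

/-- **`R(h)((f∘H)·φ) = (g∘H)·φ` POINTWISE** (Iwasawa letter `hBK`).  For `h ∈ C_c(G(𝔸))` acting on the flat sections of the continuous `χ`-section `φ` by the scalar `s` (binder `hact`, all
`z`, all `x` — ★ P1), `k₀ ∈ K` with `φ(k₀) ≠ 0`, and `f ∈ C²_c((0,∞))`:
`∫ h(y)·f(H(xy))·φ(xy) dν_G(y) = g(H(x))·φ(x)` with `g(r) = ∫ f(r·H(y))·h(k₀⁻¹y)·φ(y)∕φ(k₀) dν_G`.  `x = bk`: both sides are `χ(b₀₀)` times an `r`-profile at `r = H(x)`; the profiles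
`r ↦ ∫ h f(rH(k·))φ(k·)` and `φ(k)·g` are `C²_c((0,∞))` with the same Mellin transform `s(−w)φ(k)·mellin f w`, hence equal (§1). [cite: MoeglinWaldspurger1995, II.1.2–II.1.4] [cite: BernsteinLapid2019, §4 Claim 1] -/
theorem rightConv_comp_borelHeight_mul_section (νG : Measure (quasiSplit F E c N).Adelic) [IsFiniteMeasureOnCompacts νG] [SFinite νG] [νG.IsMulLeftInvariant]
    (hBK : ∀ g : (quasiSplit F E c N).Adelic, ∃ b ∈ borelAdelic F E c N, ∃ k : (quasiSplit F E c N).Adelic, adelicVal F E c N ((StdForm.antidiagonal N).over E) k ∈ standardMaximalCompactGL N E ∧ g = b * k)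
    {h : (quasiSplit F E c N).Adelic → ℂ} (hh : Continuous h) (hhs : HasCompactSupport h) {χ : HeckeCharacter E} {φ : (quasiSplit F E c N).Adelic → ℂ} (hφ : IsChiSection χ φ) (hφc : Continuous φ)
    {k₀ : (quasiSplit F E c N).Adelic} (hk₀ : adelicVal F E c N ((StdForm.antidiagonal N).over E) k₀ ∈ standardMaximalCompactGL N E) (hx₀ : φ k₀ ≠ 0)
    {s : ℂ → ℂ} (hact : ∀ (z : ℂ) (x : (quasiSplit F E c N).Adelic), ∫ y, h y * flatSectionU φ z (x * y) ∂νG = s z * flatSectionU φ z x)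
    {f : ℝ → ℂ} (hf : ContDiff ℝ 2 f) (hfs : HasCompactSupport f) (hf0 : tsupport f ⊆ Ioi 0) (x : (quasiSplit F E c N).Adelic) :
    ∫ y, h y * (f (borelHeight (x * y) : ℝ) * φ (x * y)) ∂νG =
      (∫ y, f ((borelHeight x : ℝ) * (borelHeight y : ℝ)) * (h (k₀⁻¹ * y) * (φ y / φ k₀)) ∂νG) * φ x := by
  obtain ⟨b, hb, k, hk, rfl⟩ := hBK x
  -- the two `r`-profiles
  set Fk : ℝ → ℂ := fun r => ∫ y, f (r * (borelHeight y : ℝ)) * (h (k⁻¹ * y) * φ y) ∂νG with hFk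
  set g : ℝ → ℂ := fun r => ∫ y, f (r * (borelHeight y : ℝ)) * (h (k₀⁻¹ * y) * (φ y / φ k₀)) ∂νG with hg
  -- (1) the left side is `χ(b₀₀)·F_k(H(bk))`
  have hL : ∀ y : (quasiSplit F E c N).Adelic, h y * (f (borelHeight (b * k * y) : ℝ) * φ (b * k * y)) =
      ((χ (firstEntryUnit hb) : ℂˣ) : ℂ) * (fun y' : (quasiSplit F E c N).Adelic => f ((borelHeight (b * k) : ℝ) * (borelHeight y' : ℝ)) * (h (k⁻¹ * y') * φ y')) (k * y) := by
    intro y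
    simp only [inv_mul_cancel_left]
    rw [borelHeight_borel_mul_mul hb hk y, NNReal.coe_mul, mul_assoc b k y, hφ.borel_mul hb (k * y)]
    ring
  have hLHS : ∫ y, h y * (f (borelHeight (b * k * y) : ℝ) * φ (b * k * y)) ∂νG = ((χ (firstEntryUnit hb) : ℂˣ) : ℂ) * Fk (borelHeight (b * k) : ℝ) := by
    simp_rw [hL]
    rw [integral_const_mul, integral_mul_left_eq_self (fun y' : (quasiSplit F E c N).Adelic => f ((borelHeight (b * k) : ℝ) * (borelHeight y' : ℝ)) * (h (k⁻¹ * y') * φ y')) k]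
  -- (2) the two profiles are `C²_c((0,∞))` with the same Mellin transform
  have h1c' : Continuous fun y : (quasiSplit F E c N).Adelic => h (k⁻¹ * y) * φ y := (hh.comp (continuous_const.mul continuous_id)).mul hφc
  have h1s : HasCompactSupport fun y : (quasiSplit F E c N).Adelic => h (k⁻¹ * y) * φ y := (hhs.comp_homeomorph (Homeomorph.mulLeft k⁻¹)).mul_right
  have hFk2 : ContDiff ℝ 2 Fk := contDiff_radialConv νG h1c' h1s hf hfs
  have hFks : HasCompactSupport Fk := hasCompactSupport_radialConv νG h1s hfs hf0
  have hFk0 : tsupport Fk ⊆ Ioi 0 := tsupport_radialConv_subset_Ioi νG h1s hfs hf0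
  have hg2 : ContDiff ℝ 2 (fun r => φ k * g r) := contDiff_const.mul (contDiff_smoothingProfile νG hh hhs hφc k₀ hf hfs)
  have hgs : HasCompactSupport (fun r => φ k * g r) := (hasCompactSupport_smoothingProfile νG hhs φ k₀ hfs hf0).mul_left
  have hg0 : tsupport (fun r => φ k * g r) ⊆ Ioi 0 :=
    (tsupport_mul_subset_right : tsupport ((fun _ : ℝ => φ k) * g) ⊆ tsupport g).trans (tsupport_smoothingProfile_subset_Ioi νG hhs φ k₀ hfs hf0)
  have hmel : ∀ w : ℂ, mellin Fk w = mellin (fun r => φ k * g r) w := by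
    intro w
    have hm1 : mellin Fk w = (∫ y, h (k⁻¹ * y) * φ y * ((((borelHeight y : ℝ≥0) : ℝ) : ℂ) ^ (-w)) ∂νG) * mellin f w :=
      mellin_radialConv νG h1c' h1s hf.continuous hfs hf0 w
    have hm2 : mellin (fun r => φ k * g r) w = φ k * (s (-w) * mellin f w) := by
      rw [show (fun r => φ k * g r) = fun r => φ k • g r from rfl, mellin_const_smul, smul_eq_mul, hg,
        mellin_smoothingProfile νG hh hhs hφc hk₀ hx₀ (fun z => hact z k₀) hf.continuous hfs hf0 w]
    have hker : ∫ y, h (k⁻¹ * y) * φ y * ((((borelHeight y : ℝ≥0) : ℝ) : ℂ) ^ (-w)) ∂νG = s (-w) * φ k := by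
      rw [integral_mul_flatSectionU_eq_at_K νG h φ k w]
      have h3 := hact (-w) k
      simp only [flatSectionU_apply] at h3
      rw [h3, borelHeight_eq_one_of_mem hk, NNReal.coe_one, ofReal_one, one_cpow, mul_one]
    rw [hm1, hm2, hker]
    ring
  have heq : Fk = fun r => φ k * g r := eq_of_mellin_eq hFk2 hFks hFk0 hg2 hgs hg0 hmel
  -- (3) assemble
  rw [hLHS, heq]
  show ((χ (firstEntryUnit hb) : ℂˣ) : ℂ) * (φ k * g (borelHeight (b * k) : ℝ)) = g (borelHeight (b * k) : ℝ) * φ (b * k)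
  rw [hφ.borel_mul hb k]
  ring

end Generic

/-! ## §4 The CM pair: the Iwasawa letter discharged -/

section CM

variable (L : Type) [Field L] [NumberField L] [IsCMField L] {N : ℕ} [NeZero N]
variable [MeasurableSpace (quasiSplit (↥(maximalRealSubfield L)) L (IsCMField.complexConj L) N).Adelic] [BorelSpace (quasiSplit (↥(maximalRealSubfield L)) L (IsCMField.complexConj L) N).Adelic]

/-- **`R(h)((f∘H)·φ) = (g∘H)·φ` FOR THE CM PAIR, HYPOTHESIS-FREE IN THE IWASAWA LETTER** (★ `exists_mem_borelAdelic_mul_mem_standardMaximalCompactGL_cm`).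
[cite: MoeglinWaldspurger1995, II.1.2–II.1.4] [cite: BernsteinLapid2019, §4 Claim 1] -/
theorem rightConv_comp_borelHeight_mul_section_cm (νG : Measure (quasiSplit (↥(maximalRealSubfield L)) L (IsCMField.complexConj L) N).Adelic)
    [IsFiniteMeasureOnCompacts νG] [SFinite νG] [νG.IsMulLeftInvariant]
    {h : (quasiSplit (↥(maximalRealSubfield L)) L (IsCMField.complexConj L) N).Adelic → ℂ} (hh : Continuous h) (hhs : HasCompactSupport h)
    {χ : HeckeCharacter L} {φ : (quasiSplit (↥(maximalRealSubfield L)) L (IsCMField.complexConj L) N).Adelic → ℂ} (hφ : IsChiSection χ φ) (hφc : Continuous φ)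
    {k₀ : (quasiSplit (↥(maximalRealSubfield L)) L (IsCMField.complexConj L) N).Adelic}
    (hk₀ : adelicVal (↥(maximalRealSubfield L)) L (IsCMField.complexConj L) N ((StdForm.antidiagonal N).over L) k₀ ∈ standardMaximalCompactGL N L) (hx₀ : φ k₀ ≠ 0)
    {s : ℂ → ℂ} (hact : ∀ (z : ℂ) (x : (quasiSplit (↥(maximalRealSubfield L)) L (IsCMField.complexConj L) N).Adelic),
      ∫ y, h y * flatSectionU φ z (x * y) ∂νG = s z * flatSectionU φ z x)
    {f : ℝ → ℂ} (hf : ContDiff ℝ 2 f) (hfs : HasCompactSupport f) (hf0 : tsupport f ⊆ Ioi 0) (x : (quasiSplit (↥(maximalRealSubfield L)) L (IsCMField.complexConj L) N).Adelic) :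
    ∫ y, h y * (f (borelHeight (x * y) : ℝ) * φ (x * y)) ∂νG =
      (∫ y, f ((borelHeight x : ℝ) * (borelHeight y : ℝ)) * (h (k₀⁻¹ * y) * (φ y / φ k₀)) ∂νG) * φ x :=
  rightConv_comp_borelHeight_mul_section νG (exists_mem_borelAdelic_mul_mem_standardMaximalCompactGL_cm L) hh hhs hφ hφc hk₀ hx₀ hact hf hfs hf0 x

end CM

end Summit.HodgeConjecture.HodgeConjecture.Cruxes.H413.K2E1ChiSectionSmoothingProfileU2

end
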